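import Literature.Analysis.Complex.AffineHypersurfaceInterpolation
import Literature.Analysis.Complex.AffineHypersurfaceFibreSums
import Literature.Analysis.Complex.EntireQuotientPolynomial
import Literature.RingTheory.MvPolynomial.HankelDiscriminant
import HarnessLib

/-!
# Serre's algebraisation lemma on a smooth affine hypersurface in Noether normal form

Layer `Literature/Analysis/Complex`. Let `P = Σ_j a_j(w) X^j`, `a_j ∈ ℂ[w₁, …, w_m]`, be MONIC IN `t` up to the
constant `c ≠ 0` (`P.coeff d = c`, `deg a_j + j ≤ d`), and suppose the top-degree family `Σ_j (a_j)_{(d-j)} X^j` has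
a fibre with `d` distinct roots (the hyperplane section at infinity is reduced along a transversal line). Let `g` be a
function on the hypersurface `U = {(w, t) | P_w(t) = 0} ⊂ ℂ^m × ℂ` which is locally the restriction of holomorphic
functions of `ℂ^m × ℂ` (this holds for holomorphic functions on `U` when `U` is SMOOTH) and has polynomial growth
`|g| ≤ C (1 + |(w, t)|)^k` on `U`. Then **`g` is the restriction of a polynomial of total degree `≤ k`**
(`exists_mvPolynomial_eq_on_hypersurface`).

Proof (Serre, GAGA n° 19 Lemme 8 and n° 20; SGA 1 XII Thm. 5.1, proof, part 2 — on the tree's carriers): the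
Lagrange interpolation polynomial `L_w(t) = Σ_j a_j(w) t^j` of `g(w, ·)` at the roots of `P_w` (off the Hankel
discriminant `Δ`) has ENTIRE coefficients `ã_j` (`exists_differentiable_eq_coeff_interpolate`) satisfying the Hankel
system `Σ_j S_{l+j} ã_j = b_l` with the power-sum polynomials `S_n` (`exists_powerSums`) and the fibre-sum
POLYNOMIALS `b_l`, `deg b_l ≤ k + l` (`exists_mvPolynomial_fibreSum`); by Cramer `Δ ã_j = Σ_l adj_{jl} b_l =: P_j`
with `deg P_j + j ≤ d(d-1) + k` (`totalDegree_adjugate_add_le`), so `ã_j` is a polynomial `A_j` with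
`deg Δ + deg A_j = deg P_j` (`exists_mvPolynomial_eval_eq_of_eval_mul_eq`), i.e. `deg A_j + j ≤ k` since
`deg Δ = d(d-1)`; the polynomial `q = Σ_j A_j t^j` of degree `≤ k` interpolates `g` on the fibres with distinct roots,
hence equals `g` on all of `U` by continuity (every root of `P_{w*}` is a limit of roots of nearby generic fibres,
`exists_clusters`).

Everything is proved; no definitions, no named facts.

## References

* J.-P. Serre, *Géométrie algébrique et géométrie analytique*, Ann. Inst. Fourier 6 (1956), n° 19 Lemme 8, n° 20. [SerreGAGA1956]
* A. Grothendieck, M. Raynaud, SGA 1, Exp. XII, Thm. 5.1 (proof, part 2).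
-/

noncomputable section

open Polynomial Complex Metric Set Filter Finset Lagrange
open scoped Topology

namespace Literature.Analysis.Complex

namespace AffineHypersurface

open SCV Literature.RingTheory.MvPolynomial.NewtonPowerSums EntireQuotient

variable {m d : ℕ} {c : ℂ} (P : Polynomial (MvPolynomial (Fin m) ℂ))

/-- **`g` is continuous on the hypersurface** (it is locally a restriction of holomorphic functions): for
`(w*, t*) ∈ U` and `ε > 0` there is `δ > 0` with `|g(x) - g(w*, t*)| < ε` for `x ∈ U`, `|x - (w*, t*)| < δ`.
[cite: SerreGAGA1956, n° 20] -/
theorem continuousWithinAt_of_hhol {g : (Fin m → ℂ) × ℂ → ℂ}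
    (hhol : ∀ x : (Fin m → ℂ) × ℂ, (P.map (MvPolynomial.eval x.1)).eval x.2 = 0 →
      ∃ W : Set ((Fin m → ℂ) × ℂ), IsOpen W ∧ x ∈ W ∧ ∃ G : (Fin m → ℂ) × ℂ → ℂ, DifferentiableOn ℂ G W ∧
        ∀ y ∈ W, (P.map (MvPolynomial.eval y.1)).eval y.2 = 0 → G y = g y)
    {x : (Fin m → ℂ) × ℂ} (hx : (P.map (MvPolynomial.eval x.1)).eval x.2 = 0) :
    ContinuousWithinAt g {y | (P.map (MvPolynomial.eval y.1)).eval y.2 = 0} x := by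
  obtain ⟨W, hWo, hxW, G, hG, hGg⟩ := hhol x hx
  have hGc : ContinuousAt G x := (hG.differentiableAt (hWo.mem_nhds hxW)).continuousAt
  refine (hGc.continuousWithinAt.congr_of_eventuallyEq ?_ (hGg x hxW hx).symm)
  filter_upwards [mem_nhdsWithin_of_mem_nhds (hWo.mem_nhds hxW), self_mem_nhdsWithin] with y hyW hy
  exact (hGg y hyW hy).symm

/-- **Every point of `U` is a limit of points of `U` over the generic fibres**: if `δ ≠ 0` is a polynomial in `w`,
then for `(w*, t*) ∈ U` and `η > 0` there is `(w, t) ∈ U` with `δ(w) ≠ 0`, `|w - w*| < η`, `|t - t*| < η` (the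
disc around the root `t*` keeps `mult(t*) ≥ 1` roots of `P_w` for `w` near `w*`, `exists_clusters`).
[cite: SerreGAGA1956, n° 20] -/
theorem exists_generic_point_near (hc : c ≠ 0) (hPd : P.natDegree ≤ d) (hPlead : P.coeff d = MvPolynomial.C c)
    {L : ℝ} (hL : 1 ≤ L)
    (hroot : ∀ (w : Fin m → ℂ) (t : ℂ), (P.map (MvPolynomial.eval w)).IsRoot t → ‖t‖ ≤ L * (1 + ‖w‖))
    (δ : MvPolynomial (Fin m) ℂ) (hδ0 : δ ≠ 0) {w₀ : Fin m → ℂ} {t₀ : ℂ}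
    (h0 : (P.map (MvPolynomial.eval w₀)).eval t₀ = 0) {η : ℝ} (hη : 0 < η) :
    ∃ (w : Fin m → ℂ) (t : ℂ), MvPolynomial.eval w δ ≠ 0 ∧ (P.map (MvPolynomial.eval w)).eval t = 0 ∧
      dist w w₀ < η ∧ dist t t₀ < η := by
  classical
  have hne0 := map_eval_ne_zero P hc hPlead
  obtain ⟨ε, hε, hε1, hεη, hsep⟩ := exists_separation (P.map (MvPolynomial.eval w₀)).roots.toFinset hη
  have hsep' : ∀ τ ∈ (P.map (MvPolynomial.eval w₀)).roots, ∀ τ' ∈ (P.map (MvPolynomial.eval w₀)).roots,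
      τ ≠ τ' → 2 * ε < dist τ τ' := fun τ hτ τ' hτ' hne ↦
    hsep τ (Multiset.mem_toFinset.mpr hτ) τ' (Multiset.mem_toFinset.mpr hτ') hne
  obtain ⟨δ', hδ', -, hV, hcard, -⟩ := exists_clusters P hc hPd hPlead hL hroot w₀ hε hε1 hsep'
  have ht₀ : t₀ ∈ (P.map (MvPolynomial.eval w₀)).roots.toFinset :=
    Multiset.mem_toFinset.mpr ((mem_roots (hne0 w₀)).mpr h0)
  -- a parameter `w` near `w₀` off the discriminant
  have hdense : Dense {w : Fin m → ℂ | MvPolynomial.eval w δ ≠ 0} := BranchedCoveringSCV.dense_setOf_eval_ne_zero hδ0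
  obtain ⟨w, hwball, hwδ⟩ := hdense.inter_open_nonempty (ball w₀ (min δ' η)) isOpen_ball
    ⟨w₀, mem_ball_self (lt_min hδ' hη)⟩
  have hwδ' : w ∈ ball w₀ δ' := ball_subset_ball (min_le_left _ _) hwball
  -- a root of `P_w` in the disc around `t₀`
  have hpos : 0 < Multiset.card (sliceRoots (fun x : (Fin m → ℂ) × ℂ ↦ (P.map (MvPolynomial.eval x.1)).eval x.2)
      t₀ ε w) := by
    rw [hcard t₀ ht₀ w hwδ', Multiset.count_pos]
    exact (mem_roots (hne0 w₀)).mpr h0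
  obtain ⟨t, ht⟩ := Multiset.card_pos_iff_exists_mem.mp hpos
  have hV₀ := hV t₀ ht₀
  obtain ⟨htball, ht0⟩ := (mem_rootMultiset_iff (hV₀.differentiableOn_slice hwδ') hV₀.pos hV₀.lt
    (hV₀.ne_zero w hwδ')).mp ht
  refine ⟨w, t, hwδ, ht0, ?_, ?_⟩
  · exact (mem_ball.mp hwball).trans_le (min_le_right _ _)
  · exact (mem_ball.mp htball).trans_le hεη


/-- **Sums over the distinct roots off the discriminant**: when the roots of `P_w` are distinct,
`Σ_{ρ ∈ roots} f(ρ) = Σ_{r ∈ roots.toFinset} f(r)`. [cite: SerreGAGA1956, n° 20] -/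
theorem multiset_roots_map_sum_eq {w : Fin m → ℂ} (hnd : (P.map (MvPolynomial.eval w)).roots.Nodup) (f : ℂ → ℂ) :
    ((P.map (MvPolynomial.eval w)).roots.map f).sum = ∑ r ∈ (P.map (MvPolynomial.eval w)).roots.toFinset, f r := by
  rw [Finset.sum_eq_multiset_sum, Multiset.toFinset_val, Multiset.dedup_eq_self.mpr hnd]

/-- **Serre's algebraisation lemma on a smooth affine hypersurface in Noether normal form.** For the family
`P = Σ a_j(w) X^j` (`P.coeff d = c ≠ 0` constant, `deg a_j + j ≤ d`, some fibre of the top-degree family with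
distinct roots) and a function `g` on `U = {P_w(t) = 0}` locally the restriction of holomorphic functions of
`ℂ^m × ℂ`, of growth `|g| ≤ C (1 + |(w,t)|)^k` on `U`, there is a polynomial `q ∈ ℂ[t, w]` of total degree `≤ k` with
`q = g` on `U`. [cite: SerreGAGA1956, n° 19 Lemme 8 and n° 20] -/
theorem exists_mvPolynomial_eq_on_hypersurface (hc : c ≠ 0) (hPd : P.natDegree ≤ d)
    (hPlead : P.coeff d = MvPolynomial.C c) (hPcoef : ∀ j, (P.coeff j).totalDegree + j ≤ d)
    (hsep : ∃ w₀ : Fin m → ℂ, ((∑ j ∈ range (d + 1), Polynomial.monomial j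
      (MvPolynomial.homogeneousComponent (d - j) (P.coeff j))).map (MvPolynomial.eval w₀)).roots.Nodup)
    {g : (Fin m → ℂ) × ℂ → ℂ}
    (hhol : ∀ x : (Fin m → ℂ) × ℂ, (P.map (MvPolynomial.eval x.1)).eval x.2 = 0 →
      ∃ W : Set ((Fin m → ℂ) × ℂ), IsOpen W ∧ x ∈ W ∧ ∃ G : (Fin m → ℂ) × ℂ → ℂ, DifferentiableOn ℂ G W ∧
        ∀ y ∈ W, (P.map (MvPolynomial.eval y.1)).eval y.2 = 0 → G y = g y)
    {C : ℝ} (hC : 0 ≤ C) {k : ℕ}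
    (hgr : ∀ x : (Fin m → ℂ) × ℂ, (P.map (MvPolynomial.eval x.1)).eval x.2 = 0 → ‖g x‖ ≤ C * (1 + ‖x‖) ^ k) :
    ∃ q : MvPolynomial (Fin (m + 1)) ℂ, q.totalDegree ≤ k ∧
      ∀ (w : Fin m → ℂ) (t : ℂ), (P.map (MvPolynomial.eval w)).eval t = 0 →
        MvPolynomial.eval (Fin.cons t w : Fin (m + 1) → ℂ) q = g (w, t) := by
  classical
  obtain ⟨L, hL, hroot⟩ := exists_norm_root_le P hc hPd hPlead hPcoef
  obtain ⟨S, hSeval, hSdeg, hΔdeg, hΔne, hΔnodup⟩ := exists_powerSums P hc hPd hPlead hPcoef hsep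
  set H : Matrix (Fin d) (Fin d) (MvPolynomial (Fin m) ℂ) := Matrix.of fun i j : Fin d ↦ S (i.1 + j.1) with hH
  have hne0 := map_eval_ne_zero P hc hPlead
  -- fibre sums and interpolation coefficients
  choose b hbdeg hbeval using fun l ↦ exists_mvPolynomial_fibreSum P hc hPd hPlead hL hroot hhol hC hgr l
  choose a hadiff haeq using fun j ↦ exists_differentiable_eq_coeff_interpolate P hc hPd hPlead hL hroot hhol
    H.det hΔne (fun w hw ↦ (hΔnodup w).mp hw) j
  -- the Hankel system `Σ_j S_{l+j}(w) a_j(w) = b_l(w)`, off the discriminant and then everywhere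
  have hsys : ∀ (l : ℕ) (w : Fin m → ℂ), ∑ j ∈ range d, MvPolynomial.eval w (S (l + j)) * a j w =
      MvPolynomial.eval w (b l) := by
    intro l
    have hdense : Dense {w : Fin m → ℂ | MvPolynomial.eval w H.det ≠ 0} :=
      BranchedCoveringSCV.dense_setOf_eval_ne_zero hΔne
    have hclosed : IsClosed {w : Fin m → ℂ | ∑ j ∈ range d, MvPolynomial.eval w (S (l + j)) * a j w =
        MvPolynomial.eval w (b l)} := by
      refine isClosed_eq ?_ (BranchedCoveringSCV.differentiable_eval (b l)).continuous
      exact continuous_finsetSum _ fun j _ ↦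
        (BranchedCoveringSCV.differentiable_eval _).continuous.mul (hadiff j).continuous
    have hsub : {w : Fin m → ℂ | MvPolynomial.eval w H.det ≠ 0} ⊆ {w | ∑ j ∈ range d,
        MvPolynomial.eval w (S (l + j)) * a j w = MvPolynomial.eval w (b l)} := by
      intro w hw
      have hnd : (P.map (MvPolynomial.eval w)).roots.Nodup := (hΔnodup w).mp hw
      set R := (P.map (MvPolynomial.eval w)).roots.toFinset with hR
      have hRcard : R.card = d := by
        rw [hR, Multiset.toFinset_card_of_nodup hnd, card_roots_map_eval P hc hPd hPlead]
      show ∑ j ∈ range d, MvPolynomial.eval w (S (l + j)) * a j w = MvPolynomial.eval w (b l)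
      have h1 := LagrangeContour.sum_powerSum_mul_coeff_interpolate R (fun r ↦ g (w, r)) l
      rw [hRcard] at h1
      rw [hbeval, multiset_roots_map_sum_eq P hnd, ← h1]
      refine Finset.sum_congr rfl fun j _ ↦ ?_
      rw [hSeval, multiset_roots_map_sum_eq P hnd, haeq j w hw]
    intro w
    have : w ∈ {w : Fin m → ℂ | ∑ j ∈ range d, MvPolynomial.eval w (S (l + j)) * a j w =
        MvPolynomial.eval w (b l)} := by
      rw [← hclosed.closure_eq]
      exact (hdense.mono hsub).closure_eq ▸ mem_univ w
    exact this
  -- Cramer: `Δ(w) a_j(w) = (adj H · b)_j (w)`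
  set Pj : Fin d → MvPolynomial (Fin m) ℂ := fun j ↦ ∑ l, H.adjugate j l * b l.1 with hPj
  have hcramer : ∀ (j : Fin d) (w : Fin m → ℂ), MvPolynomial.eval w H.det * a j.1 w = MvPolynomial.eval w (Pj j) := by
    intro j w
    set Hw : Matrix (Fin d) (Fin d) ℂ := (MvPolynomial.eval w).mapMatrix H with hHw
    have hmul : Matrix.mulVec Hw (fun j : Fin d ↦ a j.1 w) = fun l : Fin d ↦ MvPolynomial.eval w (b l.1) := by
      funext l
      rw [Matrix.mulVec, dotProduct]
      simp only [hHw, RingHom.mapMatrix_apply, Matrix.map_apply, hH, Matrix.of_apply]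
      rw [← hsys l.1 w, Finset.sum_fin_eq_sum_range]
      refine Finset.sum_congr rfl fun j hj ↦ ?_
      rw [dif_pos (Finset.mem_range.mp hj)]
    have hadj := congrArg (fun v ↦ Matrix.mulVec (H.adjugate.map (MvPolynomial.eval w)) v) hmul
    beta_reduce at hadj
    rw [Matrix.mulVec_mulVec, show H.adjugate.map (MvPolynomial.eval w) = Hw.adjugate by
        rw [hHw, ← RingHom.mapMatrix_apply, RingHom.map_adjugate], Matrix.adjugate_mul, Matrix.smul_mulVec,
      Matrix.one_mulVec] at hadj
    have hj := congrFun hadj j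
    simp only [Pi.smul_apply, smul_eq_mul] at hj
    rw [hHw, ← RingHom.map_det] at hj
    have hmap : ∀ l, ((MvPolynomial.eval w).mapMatrix H).adjugate j l = MvPolynomial.eval w (H.adjugate j l) := by
      intro l
      have := congrFun (congrFun (RingHom.map_adjugate (MvPolynomial.eval w) H) j) l
      rw [RingHom.mapMatrix_apply, Matrix.map_apply] at this
      exact this.symm
    rw [hj, hPj]
    simp only [map_sum, map_mul, Matrix.mulVec, dotProduct, hmap]
  -- the `a_j` are polynomials `A_j` with `deg A_j + j ≤ k`
  have hHdeg : ∀ i j : Fin d, (H i j).totalDegree ≤ i.1 + j.1 := fun i j ↦ by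
    simp only [hH, Matrix.of_apply]; exact hSdeg _
  have hdpos : ∀ j : Fin d, j.1 ≤ d * (d - 1) + k := by
    intro j
    have hj := j.2
    have h1 : d - 1 ≤ d * (d - 1) := Nat.le_mul_of_pos_left (d - 1) (by omega)
    omega
  have hA : ∀ j : Fin d, ∃ A : MvPolynomial (Fin m) ℂ, (A ≠ 0 → A.totalDegree + j.1 ≤ k) ∧
      ∀ w, MvPolynomial.eval w A = a j.1 w := by
    intro j
    obtain ⟨A, hΔA, hAeval⟩ := exists_mvPolynomial_eval_eq_of_eval_mul_eq hΔne (hadiff j.1).continuous (hcramer j)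
    refine ⟨A, fun hA0 ↦ ?_, hAeval⟩
    have hdeg := totalDegree_add_eq_of_mul_eq hΔne hA0 hΔA
    have hterm : ∀ l : Fin d, (H.adjugate j l * b l.1).totalDegree + j.1 ≤ d * (d - 1) + k := by
      intro l
      have h1 := totalDegree_adjugate_add_le H hHdeg j l
      have h2 := hbdeg l.1
      have h3 := MvPolynomial.totalDegree_mul (H.adjugate j l) (b l.1)
      omega
    have hPjdeg : (Pj j).totalDegree + j.1 ≤ d * (d - 1) + k := by
      have hsup : (Pj j).totalDegree ≤ d * (d - 1) + k - j.1 := by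
        refine (MvPolynomial.totalDegree_finsetSum _ _).trans (Finset.sup_le fun l _ ↦ ?_)
        have := hterm l
        omega
      have := hdpos j
      omega
    rw [hΔdeg] at hdeg
    omega
  choose A hAdeg hAeval using hA
  -- the polynomial `q = Σ_j A_j t^j`
  refine ⟨∑ j : Fin d, MvPolynomial.rename Fin.succ (A j) * MvPolynomial.X 0 ^ j.1, ?_, ?_⟩
  · refine (MvPolynomial.totalDegree_finsetSum _ _).trans (Finset.sup_le fun j _ ↦ ?_)
    by_cases hA0 : A j = 0
    · simp [hA0]
    · refine (MvPolynomial.totalDegree_mul _ _).trans ?_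
      refine (add_le_add (MvPolynomial.totalDegree_rename_le _ _) (MvPolynomial.totalDegree_pow _ _)).trans ?_
      rw [MvPolynomial.totalDegree_X, mul_one]
      exact hAdeg j hA0
  · -- `q = g` on `U`
    have hevalq : ∀ (w : Fin m → ℂ) (t : ℂ), MvPolynomial.eval (Fin.cons t w : Fin (m + 1) → ℂ)
        (∑ j : Fin d, MvPolynomial.rename Fin.succ (A j) * MvPolynomial.X 0 ^ j.1) = ∑ j : Fin d, a j.1 w * t ^ j.1 := by
      intro w t
      rw [map_sum]
      refine Finset.sum_congr rfl fun j _ ↦ ?_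
      rw [map_mul, map_pow, MvPolynomial.eval_X, Fin.cons_zero, MvPolynomial.eval_rename,
        show ((Fin.cons t w : Fin (m + 1) → ℂ) ∘ Fin.succ) = w from funext fun i ↦ by simp, hAeval]
    -- on the generic fibres
    have hgen : ∀ (w : Fin m → ℂ) (t : ℂ), MvPolynomial.eval w H.det ≠ 0 → (P.map (MvPolynomial.eval w)).eval t = 0 →
        ∑ j : Fin d, a j.1 w * t ^ j.1 = g (w, t) := by
      intro w t hw ht
      have hnd : (P.map (MvPolynomial.eval w)).roots.Nodup := (hΔnodup w).mp hw
      set R := (P.map (MvPolynomial.eval w)).roots.toFinset with hR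
      have hRcard : R.card = d := by
        rw [hR, Multiset.toFinset_card_of_nodup hnd, card_roots_map_eval P hc hPd hPlead]
      have htR : t ∈ R := Multiset.mem_toFinset.mpr ((mem_roots (hne0 w)).mpr ht)
      have h1 := LagrangeContour.sum_coeff_interpolate_mul_pow R htR (fun r ↦ g (w, r))
      rw [hRcard, Finset.sum_range (fun j ↦ (interpolate R id fun r ↦ g (w, r)).coeff j * t ^ j)] at h1
      rw [← h1]
      exact Finset.sum_congr rfl fun j _ ↦ by rw [haeq j.1 w hw]
    -- everywhere on `U`, by continuity
    intro w₀ t₀ h0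
    rw [hevalq]
    set φ : (Fin m → ℂ) × ℂ → ℂ := fun x ↦ ∑ j : Fin d, a j.1 x.1 * x.2 ^ j.1 - g x with hφ
    have hφcont : ContinuousWithinAt φ {y | (P.map (MvPolynomial.eval y.1)).eval y.2 = 0} (w₀, t₀) := by
      refine ContinuousWithinAt.sub (Continuous.continuousWithinAt ?_) (continuousWithinAt_of_hhol P hhol h0)
      exact continuous_finsetSum _ fun j _ ↦
        (((hadiff j.1).continuous).comp continuous_fst).mul (continuous_snd.pow _)
    by_contra hne
    have hφ0 : φ (w₀, t₀) ≠ 0 := fun h ↦ hne (sub_eq_zero.mp h)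
    have hεpos : 0 < ‖φ (w₀, t₀)‖ / 2 := by positivity
    obtain ⟨η, hη, hηφ⟩ := Metric.continuousWithinAt_iff.mp hφcont _ hεpos
    obtain ⟨w, t, hwΔ, hwt, hdw, hdt⟩ := exists_generic_point_near P hc hPd hPlead hL hroot H.det hΔne h0 hη
    have hzero : φ (w, t) = 0 := sub_eq_zero.mpr (hgen w t hwΔ hwt)
    have hdist : dist ((w, t) : (Fin m → ℂ) × ℂ) (w₀, t₀) < η := by
      rw [Prod.dist_eq]; exact max_lt hdw hdt
    have := hηφ hwt hdist
    rw [hzero, dist_zero_left] at this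
    linarith

end AffineHypersurface

end Literature.Analysis.Complex
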